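import Summits.CriticalPhenomena.Ising3DConformalLimit.Theorems.EnergyNotSigmaSquaredGapForcesFarMergingSandwichNearPinchFloor
import Summits.CriticalPhenomena.Ising3DConformalLimit.Theorems.EnergyNotSigmaSquaredGapForcesFarMergingSandwichOctaveCountingAux
import Summits.CriticalPhenomena.Ising3DConformalLimit.Theorems.EnergyNotSigmaSquaredGapForcesFarMergingSandwichTailTightnessFarTail
import HarnessLib

/-! # Octave counting, final form: decay + hazard domination over all octaves force far duplicated hitting
(line `one-cluster-depletion-sandwich` of crux `GapForcesFarMerging`, item stmt-CriticalPhenomena-4468;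
stub `stub_octaveCountingFinal` of the reshaped skeleton v3)

`OnePinchDecay → HazardDominationExt → FarHitIO`. This is the bookkeeping `octaveCounting_of_floor` of the
sibling file `…SandwichOctaveCountingAux` (whose elementary lemmas `OctaveCountingProof.*` are reused) with two
changes: the telescoping over the conditional hazards of the one-pinch system now runs over ALL octaves
`k₀ < k ≤ 5K+3` (the range of `HazardDominationExt`), and the open currency `TailTightness` is replaced by
the PROVED far tail `TailTightnessProof.farTail_dyadic` (sibling file `…SandwichTailTightnessFarTail`:
`avoidIn n (2^{4K+k}) (pinch K) - avoid n (pinch K) ≤ C_t 2^{-k}`, eventually in `n`, uniformly in `k`); the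
floor is the landed near-pinch floor `nearPinchFloor` (sibling file `…SandwichNearPinchFloor`).

Proof (by contradiction). Assume `¬FarHitIO`. With `κ, C_d, θ` from `OnePinchDecay` put `ρ = 2^{-κ} < 1`,
`σ = max ρ ½ < 1`, `λ = 1 - (1-σ)/10 ∈ (0,1)` and `μ = λ⁵`; Bernoulli gives `μ ≥ 1 - (1-σ)/2 > σ`, so
`ρ/μ < 1` and `1/(2μ) < 1`. Put `η = (1-λ)/2` and, with `M, k₁, C, ε` from `HazardDominationExt θ`,
`c = η/(|C|+1)`. By `¬FarHitIO`, for each of the finitely many injective shapes `y ∈ (Λ_M)⁴` and all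
dilations `L ≥ J₀`, eventually in `n`, `meet n (L•y) < c`; choose `k₀ ≥ J₀ + k₁` with `ε_k < η` beyond `k₀`,
and `δ₀ > 0` from the near-pinch floor at radius `2^{k₀}`. Pick (`∃ᶠ K`) a doubling octave `K > k₀` carrying
the decay bound with `C_d (ρ/μ)^K < δ₀λ³/2` and `C_t (2μ)^{-K} < δ₀λ³/2`, then one box size `n` at which decay,
far tail, floor, the `5K+3-k₀` hazard bounds and all smallness statements hold. There every hazard is
`≤ Cc + ε_k ≤ 1-λ`, so `avoidIn n (2^{5K+3}) ≥ λ^{5K+3-k₀} δ₀ ≥ δ₀ λ³ μ^K`, while the far tail at `k = K+3`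
and the decay give `avoidIn n (2^{5K+3}) ≤ avoid n (pinch K) + C_t 2^{-K-3} ≤ C_d ρ^K + C_t 2^{-K}
< δ₀ λ³ μ^K`, absurd. References: Aizenman–Duminil-Copin 2021, §6.2 (6.11)–(6.13) and §4.2; Lawler 1991, ch. 3–5. -/

noncomputable section

namespace Summit.CriticalPhenomena.Ising3DConformalLimit.EnergyNotSigmaSquaredGapForcesFarMergingSandwich

namespace OctaveCountingFinalProof

open scoped symmDiff ENNReal
open MeasureTheory Filter
open Literature.Probability.LatticeModels Literature.Probability.Percolation
open Summit.CriticalPhenomena.Ising3DConformalLimit.GapForcesFarMergingSandwich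
open Summit.CriticalPhenomena.Ising3DConformalLimit.Theses.EnergyNotSigmaSquared
open OctaveCountingProof

/-- **Rates**: for `0 < ρ < 1` there is `λ ∈ (0,1)` with `ρ < λ⁵` and `1/2 < λ⁵` (Bernoulli with
`λ = 1 - (1 - max ρ ½)/10`). [folklore] -/
theorem exists_rate (ρ : ℝ) (hρlt : ρ < 1) :
    ∃ lam : ℝ, 0 < lam ∧ lam < 1 ∧ ρ < lam ^ 5 ∧ 1 / 2 < lam ^ 5 := by
  set σ : ℝ := max ρ (1 / 2) with hσ
  have hσlt : σ < 1 := max_lt hρlt (by norm_num)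
  have hρσ : ρ ≤ σ := le_max_left _ _
  have hhalfσ : 1 / 2 ≤ σ := le_max_right _ _
  refine ⟨1 - (1 - σ) / 10, by linarith, by linarith, ?_⟩
  have hB : 1 + ((5 : ℕ) : ℝ) * (-((1 - σ) / 10)) ≤ (1 + -((1 - σ) / 10)) ^ 5 :=
    one_add_mul_le_pow (by linarith) 5
  have h1 : (1 : ℝ) + -((1 - σ) / 10) = 1 - (1 - σ) / 10 := by ring
  rw [h1] at hB
  push_cast at hB
  constructor <;> linarith

/-- **Octave counting, final form, given the near-pinch floor and the dyadic far tail**: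
`OnePinchDecay → HazardDominationExt → FarHitIO` assuming the floor
`∀ R, ∃ δ₀ > 0, ∀ K, R < 2^K → ∀ᶠ n, δ₀ ≤ avoidIn n R (pinch K)` and the far tail
`∃ C ≥ 0, ∀ K, ∀ᶠ n, ∀ k, avoidIn n (2^{4K+k}) (pinch K) - avoid n (pinch K) ≤ C/2^k` (both proved in sibling files).
[cite: AizenmanDuminilCopinAnnals2021, §6.2 (6.11)–(6.13)] -/
theorem farHitIO_of_floor_farTail
    (hfloor : ∀ R : ℕ, ∃ δ₀ : ℝ, 0 < δ₀ ∧ ∀ K : ℕ, R < 2 ^ K → ∀ᶠ n : ℕ in atTop, δ₀ ≤ avoidIn n R (pinch K))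
    (htail : ∃ C : ℝ, 0 ≤ C ∧ ∀ K : ℕ, ∀ᶠ n : ℕ in atTop, ∀ k : ℕ,
      avoidIn n (2 ^ (4 * K + k)) (pinch K) - avoid n (pinch K) ≤ C / 2 ^ k)
    (hdecay : OnePinchDecay) (hhaz : HazardDominationExt) : FarHitIO := by
  by_contra hfar
  obtain ⟨κ, Cd, θ, hκ, hθ, hfreq⟩ := hdecay
  obtain ⟨M, k₁, Ch, ε, hε, hhazK⟩ := hhaz θ hθ
  obtain ⟨Ct, hCt, htailK⟩ := htail
  -- rates
  set ρ : ℝ := (2 : ℝ) ^ (-κ) with hρ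
  have hρpos : 0 < ρ := Real.rpow_pos_of_pos two_pos _
  have hρlt : ρ < 1 := Real.rpow_lt_one_of_one_lt_of_neg one_lt_two (neg_lt_zero.2 hκ)
  obtain ⟨lam, hlam_pos, hlam_lt, hρμ, hhalfμ⟩ := exists_rate ρ hρlt
  set μ : ℝ := lam ^ 5 with hμ
  have hμpos : 0 < μ := pow_pos hlam_pos 5
  set η : ℝ := (1 - lam) / 2 with hη
  have hηpos : 0 < η := by rw [hη]; linarith
  set c : ℝ := η / (|Ch| + 1) with hc
  have hcpos : 0 < c := by positivity
  have hCc : Ch * c ≤ η := by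
    have h1 : Ch * c ≤ |Ch| * c := mul_le_mul_of_nonneg_right (le_abs_self Ch) hcpos.le
    have h2 : |Ch| * c ≤ η := by
      rw [hc, mul_div_assoc', div_le_iff₀ (by positivity)]
      nlinarith [abs_nonneg Ch]
    exact h1.trans h2
  -- smallness of the fresh hittings beyond a dilation `J₀`, over the finite family of shapes
  have hfam : ∀ᶠ L : ℕ in atTop, ∀ y ∈ Fintype.piFinset (fun _ : Fin 4 => box 3 M), Function.Injective y →
      ∀ᶠ n : ℕ in atTop, meet n (fun i => (L : ℤ) • y i) < c := by
    refine (Filter.eventually_all_finset _).2 fun y _ => ?_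
    by_cases hinj : Function.Injective y
    · exact (eventually_meet_lt_of_not_farHitIO hfar hcpos y hinj).mono fun L hL _ => hL
    · exact Filter.Eventually.of_forall fun L h => absurd h hinj
  obtain ⟨J₀, hJ₀⟩ := Filter.eventually_atTop.1 hfam
  -- smallness of `ε`
  obtain ⟨k₂, hk₂⟩ := Filter.eventually_atTop.1 (hε.eventually_lt_const hηpos)
  -- the near scale `k₀` and its floor
  set k₀ : ℕ := J₀ + k₁ + k₂ + 1 with hk₀
  obtain ⟨δ₀, hδ₀, hfloorK⟩ := hfloor (2 ^ k₀)
  -- a far doubling octave `K` carrying the decay bound, with `C_d (ρ/μ)^K, C_t (2μ)^{-K} < δ₀ λ³ / 2`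
  have hKev₁ : ∀ᶠ K : ℕ in atTop, Cd * (ρ / μ) ^ K < δ₀ * lam ^ 3 / 2 := by
    have ht : Tendsto (fun K : ℕ => Cd * (ρ / μ) ^ K) atTop (nhds (Cd * 0)) :=
      (tendsto_pow_atTop_nhds_zero_of_lt_one (div_nonneg hρpos.le hμpos.le)
        ((div_lt_one hμpos).2 hρμ)).const_mul Cd
    rw [mul_zero] at ht
    exact ht.eventually_lt_const (by positivity)
  have hKev₂ : ∀ᶠ K : ℕ in atTop, Ct * (2 * μ)⁻¹ ^ K < δ₀ * lam ^ 3 / 2 := by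
    have ht : Tendsto (fun K : ℕ => Ct * (2 * μ)⁻¹ ^ K) atTop (nhds (Ct * 0)) :=
      (tendsto_pow_atTop_nhds_zero_of_lt_one (by positivity)
        (inv_lt_one_of_one_lt₀ (by linarith))).const_mul Ct
    rw [mul_zero] at ht
    exact ht.eventually_lt_const (by positivity)
  obtain ⟨K, ⟨hKdoub, hKdec⟩, hKge, hK₁, hK₂⟩ :=
    (hfreq.and_eventually ((eventually_ge_atTop (k₀ + 1)).and (hKev₁.and hKev₂))).exists
  -- everything, eventually in `n`, at this octave
  have htailK' := htailK K
  have hfloorK' := hfloorK K (Nat.pow_lt_pow_right (by norm_num) (by omega))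
  have hhazev : ∀ᶠ n : ℕ in atTop, ∀ k ∈ Finset.Ioc k₀ (5 * K + 3), ∀ c' : ℝ,
      (∀ y : Fin 4 → Site 3, Function.Injective y → (∀ i, y i ∈ box 3 M) →
          ∀ j : ℕ, k ≤ j + k₁ → j ≤ k + 2 → meet n (fun i => ((2 : ℤ) ^ j) • y i) ≤ c') →
        avoidIn n (2 ^ (k - 1)) (pinch K) - avoidIn n (2 ^ k) (pinch K) ≤
          (Ch * c' + ε k) * avoidIn n (2 ^ (k - 1)) (pinch K) :=
    (Filter.eventually_all_finset _).2 fun k hk =>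
      hhazK k K (by rw [Finset.mem_Ioc] at hk; omega) (Finset.mem_Ioc.1 hk).2 hKdoub
  have hmeetev : ∀ᶠ n : ℕ in atTop, ∀ j ∈ Finset.Icc J₀ (5 * K + 5),
      ∀ y ∈ Fintype.piFinset (fun _ : Fin 4 => box 3 M), Function.Injective y →
        meet n (fun i => ((2 : ℤ) ^ j) • y i) < c := by
    refine (Filter.eventually_all_finset _).2 fun j hj => (Filter.eventually_all_finset _).2 fun y hy => ?_
    by_cases hinj : Function.Injective y
    · have hle : J₀ ≤ 2 ^ j := ((Finset.mem_Icc.1 hj).1).trans Nat.lt_two_pow_self.le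
      have h := hJ₀ (2 ^ j) hle y hy hinj
      rw [dilate_two_pow] at h
      exact h.mono fun n hn _ => hn
    · exact Filter.Eventually.of_forall fun n h => absurd h hinj
  obtain ⟨n, hn_dec, hn_tail, hn_floor, hn_haz, hn_meet⟩ :=
    (hKdec.and (htailK'.and (hfloorK'.and (hhazev.and hmeetev)))).exists
  -- the per-octave hazard bounds at this `n`
  have hstep : ∀ k : ℕ, k₀ < k → k ≤ 5 * K + 3 →
      lam * avoidIn n (2 ^ (k - 1)) (pinch K) ≤ avoidIn n (2 ^ k) (pinch K) := by
    intro k hk1 hk2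
    have hhyp : ∀ y : Fin 4 → Site 3, Function.Injective y → (∀ i, y i ∈ box 3 M) →
        ∀ j : ℕ, k ≤ j + k₁ → j ≤ k + 2 → meet n (fun i => ((2 : ℤ) ^ j) • y i) ≤ c := by
      intro y hy hbox j hj1 hj2
      exact (hn_meet j (Finset.mem_Icc.2 ⟨by omega, by omega⟩) y (Fintype.mem_piFinset.2 hbox) hy).le
    have hb := hn_haz k (Finset.mem_Ioc.2 ⟨hk1, hk2⟩) c hhyp
    have hεk : ε k < η := hk₂ k (by omega)
    have ha0 : 0 ≤ avoidIn n (2 ^ (k - 1)) (pinch K) := measureReal_nonneg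
    have hrate : (Ch * c + ε k) * avoidIn n (2 ^ (k - 1)) (pinch K) ≤
        (1 - lam) * avoidIn n (2 ^ (k - 1)) (pinch K) :=
      mul_le_mul_of_nonneg_right (by rw [hη] at hCc hεk; linarith) ha0
    linarith
  have hgeo := geometric_lower (a := fun k => avoidIn n (2 ^ k) (pinch K)) hlam_pos.le
    (show k₀ ≤ 5 * K + 3 by omega) hstep
  -- the lower bound from the floor and the telescoping
  have hlow : δ₀ * lam ^ 3 * μ ^ K ≤ avoidIn n (2 ^ (5 * K + 3)) (pinch K) := by
    have h1 : lam ^ (5 * K + 3) ≤ lam ^ (5 * K + 3 - k₀) :=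
      pow_le_pow_of_le_one hlam_pos.le hlam_lt.le (by omega)
    have h2 : lam ^ (5 * K + 3) = lam ^ 3 * μ ^ K := by rw [hμ]; ring
    calc δ₀ * lam ^ 3 * μ ^ K = lam ^ (5 * K + 3) * δ₀ := by rw [h2]; ring
      _ ≤ lam ^ (5 * K + 3 - k₀) * avoidIn n (2 ^ k₀) (pinch K) :=
          mul_le_mul h1 hn_floor hδ₀.le (pow_nonneg hlam_pos.le _)
      _ ≤ avoidIn n (2 ^ (5 * K + 3)) (pinch K) := hgeo
  -- the upper bound from the far tail and the decay
  have htail₁ : avoidIn n (2 ^ (5 * K + 3)) (pinch K) - avoid n (pinch K) ≤ Ct / 2 ^ (K + 3) := by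
    have h := hn_tail (K + 3)
    rwa [show 4 * K + (K + 3) = 5 * K + 3 by omega] at h
  have htail₂ : Ct / 2 ^ (K + 3) ≤ Ct / 2 ^ K :=
    div_le_div_of_nonneg_left hCt (pow_pos two_pos K) (pow_le_pow_right₀ one_le_two (by omega))
  have hdec : avoid n (pinch K) ≤ Cd * ρ ^ K := by
    have h := hn_dec
    rw [two_pow_rpow_neg, ← hρ] at h
    exact h
  have hup : avoidIn n (2 ^ (5 * K + 3)) (pinch K) < δ₀ * lam ^ 3 * μ ^ K := by
    have h1 : Cd * (ρ / μ) ^ K * μ ^ K = Cd * ρ ^ K := by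
      rw [div_pow, mul_assoc, div_mul_cancel₀ _ (pow_ne_zero K hμpos.ne')]
    have h2' : (2 * μ)⁻¹ * μ = (2 : ℝ)⁻¹ := by field_simp
    have h2 : Ct * (2 * μ)⁻¹ ^ K * μ ^ K = Ct / 2 ^ K := by
      rw [mul_assoc, ← mul_pow, h2', inv_pow, div_eq_mul_inv]
    have h3 : Cd * (ρ / μ) ^ K * μ ^ K < δ₀ * lam ^ 3 / 2 * μ ^ K :=
      mul_lt_mul_of_pos_right hK₁ (pow_pos hμpos K)
    have h4 : Ct * (2 * μ)⁻¹ ^ K * μ ^ K < δ₀ * lam ^ 3 / 2 * μ ^ K :=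
      mul_lt_mul_of_pos_right hK₂ (pow_pos hμpos K)
    rw [h1] at h3
    rw [h2] at h4
    linarith
  linarith

end OctaveCountingFinalProof

open Summit.CriticalPhenomena.Ising3DConformalLimit.GapForcesFarMergingSandwich

/-- **S5″ — OCTAVE COUNTING, FINAL FORM**: one-pinch decay along doubling octaves and per-octave hazard
domination by fresh dilated shapes over ALL octaves `1 ≤ k ≤ 5K+3` force far duplicated hitting of ONE dilated
injective lattice shape, infinitely often — the floor being the landed near-pinch floor `nearPinchFloor` and the
tail the landed far tail `TailTightnessProof.farTail_dyadic` (first moment, `≤ C·2^{-k}` beyond `Λ_{2^{4K+k}}`).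
[cite: AizenmanDuminilCopinAnnals2021, §6.2 (6.11)–(6.13)] -/
theorem stub_octaveCountingFinal : OnePinchDecay → HazardDominationExt → FarHitIO :=
  OctaveCountingFinalProof.farHitIO_of_floor_farTail nearPinchFloor TailTightnessProof.farTail_dyadic

end Summit.CriticalPhenomena.Ising3DConformalLimit.EnergyNotSigmaSquaredGapForcesFarMergingSandwich

end
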